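import Summits.BirchSwinnertonDyer.BirchSwinnertonDyer.Theorems.GoldfeldAllTwistsTwoConverseTwinAdditivePrimeTwistSelmer
import HarnessLib

set_option linter.dupNamespace false -- namespace `…BirchSwinnertonDyer.BirchSwinnertonDyer…` is the cell's (D-0017 nested layout)
set_option autoImplicit false

/-!
# Twin″ (item 19140) on the additive INERT-TWIST family, V: the `2`-isogeny Selmer sets of
# `49a1^{(−m)}`, `m` squarefree with every prime factor `≡ 1 (mod 4)` and inert in `ℚ(√−7)`

Cell `bsd-goldfeld`, seat `bsd-goldfeld-s1p-c301` (gen 2); `--supports stmt-BirchSwinnertonDyer-19140`.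
Generalises part I (`…TwinAdditivePrimeTwistSelmer.lean`, `m = ℓ` prime) to COMPOSITE `m`: the same two
containments hold for every squarefree `m ≥ 1` all of whose prime factors `ℓ` satisfy `ℓ ≡ 1 (mod 4)` and
`(−7/ℓ) = −1` (stated as `¬ IsSquare (−7 : ZMod ℓ)`), in particular for `m = 1` (the base curve
`49a1^{(−1)}` of conductor `784`) and for all products of such primes:

* `mem_of_mem_twoIsogenySelmerGroup_inertTwist`: **`S(−21m, 112m²) ⊆ {1, 2, 7, 14}`** — the real place
  kills `d < 0`; a class divisible by a prime `ℓ ∣ m` dies at `ℓ`: with `m = ℓ m₁` its quartic is `ℓ·g`,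
  `disc g = (21² − 4·112) m₁² = −7 m₁²`, a non-residue mod `ℓ` (`not_isSoluble_padic_of_prime_dvd_coeffs`
  of part I); so `d` is prime to `m`, and `d ∣ 14`.
* `mem_of_mem_twoIsogenySelmerGroup'_inertTwist`: **`S(42m, −7m²) ⊆ {1, −7}`** — at `ℓ ∣ m`:
  `(42² + 28) m₁² = 7·(16 m₁)²` and `(7/ℓ) = (−1/ℓ)(−7/ℓ) = −1`; at `7` (`7 ∤ m`, `7 ∥ 1792 m²`): `−1` and
  `−m²` are non-residues (Zywina's `isSquare_zmod_of_isSoluble_padic`).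

PARTITION: types-the-object-of the open P2 cell `r1.addv.borel.split` on the infinite sub-family
`𝒟₋₁ = {−m}` of the base family `B₋₁ = 49a1^{(−1)}` (landed `bsdTwoCMSevenAdditiveRankOne_of_baseTwists`);
the consequences (rank `≤ 1`, `Ш[2] = 0` in rank one, twin″ ⟺ a `2`-adic unit statement) are drawn in
part VII. Numerically (this seat's local script; gen 0's kit tables) `S = {1,2,7,14}`, `S' = {1,−7}`
exactly, e.g. for `m ∈ {1, 5, 13, 17, 65, 85, 221, 1105}`; of gen 0's 33 rank-one twists with
`Ш[2] ≠ 0` (`|d| ≤ 3000`) NONE has all prime factors `≡ 1 (mod 4)` and inert. HONEST FRAMING: no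
`BSD(W,2)` is proved; BSD is not proved by any of this.

## References

* J. H. Silverman, *The Arithmetic of Elliptic Curves*, 2nd ed. (2009), Prop. X.4.9, Example X.4.10.
  [SilvermanAEC2009]
* D. Zywina, arXiv:2502.01957, Lemma 3.1 (local lemmas reused from `Zywina2025RankTwo.lean`). [Zywina2025]
* B. H. Gross, *Arithmetic on Elliptic Curves with Complex Multiplication*, LNM 776 (1980), §§22–24.
  [Gross1980LNM776]
-/

noncomputable section

open scoped Classical

open WeierstrassCurve Literature.NumberTheory.EllipticCurves
open Literature.NumberTheory.EllipticCurves.Zywina2025 (isSquare_zmod_of_isSoluble_padic)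

namespace Summit.BirchSwinnertonDyer.BirchSwinnertonDyer.Theorems.GoldfeldGoodTwists

/-! ## §1. Arithmetic helpers -/

/-- A non-square stays a non-square after multiplication by a nonzero square (`ℤ/ℓ`, `ℓ` prime).
[folklore] -/
theorem not_isSquare_mul_sq_zmod {l : ℕ} [Fact l.Prime] {a k : ℤ} (hk : ((k : ℤ) : ZMod l) ≠ 0)
    (ha : ¬ IsSquare ((a : ℤ) : ZMod l)) : ¬ IsSquare (((a * k ^ 2 : ℤ)) : ZMod l) := by
  rintro ⟨r, hr⟩
  apply ha
  refine ⟨r * ((k : ℤ) : ZMod l)⁻¹, ?_⟩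
  push_cast at hr hk ⊢
  calc (a : ZMod l) = a * ((k : ZMod l) * (k : ZMod l)⁻¹) ^ 2 := by rw [mul_inv_cancel₀ hk]; ring
    _ = a * (k : ZMod l) ^ 2 * ((k : ZMod l)⁻¹) ^ 2 := by ring
    _ = r * r * ((k : ZMod l)⁻¹) ^ 2 := by rw [hr]
    _ = r * (k : ZMod l)⁻¹ * (r * (k : ZMod l)⁻¹) := by ring

/-- `(−7/ℓ) = −1` and `ℓ ≡ 1 (mod 4)` give `(7/ℓ) = −1`, in `IsSquare` language. [folklore] -/
theorem not_isSquare_seven_of_not_isSquare_neg_seven {l : ℕ} [Fact l.Prime] (hl4 : l % 4 = 1)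
    (h7 : ¬ IsSquare ((-7 : ℤ) : ZMod l)) : ¬ IsSquare ((7 : ℤ) : ZMod l) := by
  have hl2 : l ≠ 2 := by rintro rfl; norm_num at hl4
  have hleg : legendreSym l (-7) = -1 := (legendreSym.eq_neg_one_iff l).mpr h7
  have h1 : legendreSym l (-1) = 1 := by
    rw [legendreSym.at_neg_one hl2, ZMod.χ₄_nat_one_mod_four hl4]
  have hmul : legendreSym l (-7) = legendreSym l (-1) * legendreSym l 7 := by
    rw [← legendreSym.mul]; norm_num
  rw [hmul, h1, one_mul] at hleg
  exact (legendreSym.eq_neg_one_iff l).mp hleg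

/-- An integer with no prime factor in common with `m` is coprime to `m`. [folklore] -/
theorem isCoprime_of_forall_prime_not_dvd {d : ℤ} {m : ℕ}
    (h : ∀ l : ℕ, l.Prime → l ∣ m → ¬ (l : ℤ) ∣ d) : IsCoprime d (m : ℤ) := by
  rw [Int.isCoprime_iff_gcd_eq_one]
  by_contra hg
  obtain ⟨p, hp, hpd⟩ := Nat.exists_prime_and_dvd hg
  have h1 : p ∣ d.natAbs := hpd.trans (Int.gcd_dvd_natAbs_left d m)
  have h2 : p ∣ m := by
    have := hpd.trans (Int.gcd_dvd_natAbs_right d m)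
    simpa using this
  exact h p hp h2 (Int.ofNat_dvd_left.mpr h1)

/-- The `7`-adic exponent: `7 ∥ 1792 m²` when `7 ∤ m` (`1792 = 7·256`). [folklore] -/
theorem not_sq_seven_dvd_of_not_dvd {m : ℕ} (hm7 : ¬ 7 ∣ m) :
    ¬ ((7 : ℤ) ^ 2 ∣ 1792 * (m : ℤ) ^ 2) := by
  intro h
  have h7p : Prime (7 : ℤ) := Int.prime_iff_natAbs_prime.mpr (by norm_num)
  have h1 : (7 : ℤ) ∣ 256 * (m : ℤ) ^ 2 := by
    have h' : (7 : ℤ) * 7 ∣ 7 * (256 * (m : ℤ) ^ 2) := by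
      rw [← pow_two, show (7 : ℤ) * (256 * (m : ℤ) ^ 2) = 1792 * (m : ℤ) ^ 2 by ring]; exact h
    exact (mul_dvd_mul_iff_left (by norm_num : (7 : ℤ) ≠ 0)).mp h'
  rcases h7p.dvd_or_dvd h1 with h2 | h2
  · norm_num at h2
  · have h3 : (7 : ℤ) ∣ (m : ℤ) := h7p.dvd_of_dvd_pow h2
    exact hm7 (by exact_mod_cast h3)

/-- Non-residues mod `7`: `−1` and `−x²` (`x ≠ 0`). [folklore] -/
theorem zmod_seven_nonresidues_neg_one_neg_sq :
    (∀ r : ZMod 7, r * r ≠ -1) ∧ (∀ x r : ZMod 7, x ≠ 0 → r * r ≠ -x ^ 2) :=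
  ⟨by decide, by decide⟩

/-! ## §2. The Selmer sets of `E_{−m} : y² = x³ − 21m x² + 112m² x` -/

/-- **`S(−21m, 112m²) ⊆ {1, 2, 7, 14}`** (descent on the divisors of `b`; Silverman X.4.9) for squarefree
`m ≥ 1` all of whose prime factors `ℓ` have `(−7/ℓ) = −1`: the real place kills `d < 0`; each prime
`ℓ ∣ m` kills the classes divisible by `ℓ` (`m = ℓ m₁`, reduced discriminant `−7 m₁²`, a non-residue);
so `d` is prime to `m` and `d ∣ 14`. [cite: SilvermanAEC2009, Prop. X.4.9 and Example X.4.10] -/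
theorem mem_of_mem_twoIsogenySelmerGroup_inertTwist {m : ℕ} (hm0 : 0 < m) (hmsq : Squarefree m)
    (hinert : ∀ l : ℕ, l.Prime → l ∣ m → ¬ IsSquare ((-7 : ℤ) : ZMod l)) {d : ℤ}
    (hd : d ∈ twoIsogenySelmerGroup (-21 * m) (112 * m ^ 2)) :
    d ∈ ({1, 2, 7, 14} : Finset ℤ) := by
  have hm0' : (m : ℤ) ≠ 0 := by exact_mod_cast hm0.ne'
  have hb : (112 * m ^ 2 : ℤ) ≠ 0 := by positivity
  rw [mem_twoIsogenySelmerGroup_iff hb] at hd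
  obtain ⟨hsqf, ⟨d', hdd'⟩, hloc⟩ := hd
  have hd'eq : (112 * m ^ 2 : ℤ) / d = d' := by
    rw [hdd', Int.mul_ediv_cancel_left _ hsqf.ne_zero]
  rw [hd'eq] at hloc
  obtain ⟨hreal, hpadic⟩ := hloc
  -- the real place: `d > 0`
  have hdpos : 0 < d := by
    rcases lt_or_gt_of_ne hsqf.ne_zero with hneg | hpos
    · exfalso
      have hbpos : (0 : ℤ) < 112 * (m : ℤ) ^ 2 := by positivity
      have hd'neg : d' < 0 := by
        by_contra hcon
        nlinarith [mul_nonpos_iff.mpr (Or.inr ⟨hneg.le, le_of_not_gt hcon⟩)]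
      have ha : (-21 * (m : ℤ)) ≤ 0 := by
        have : (0 : ℤ) ≤ m := by positivity
        linarith
      exact not_isSoluble_real_twoIsogenyQuartic_of_neg hneg hd'neg ha hreal
    · exact hpos
  -- each prime `ℓ ∣ m`: `ℓ ∤ d`
  have hld : ∀ l : ℕ, l.Prime → l ∣ m → ¬ (l : ℤ) ∣ d := by
    intro l hl hlm
    haveI : Fact l.Prime := ⟨hl⟩
    have hlp : Prime (l : ℤ) := Nat.prime_iff_prime_int.mp hl
    have hl0 : (l : ℤ) ≠ 0 := by exact_mod_cast hl.ne_zero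
    obtain ⟨m₁, rfl⟩ := hlm
    -- `ℓ ∤ m₁` (squarefree)
    have hlm₁ : ¬ (l : ℤ) ∣ (m₁ : ℤ) := by
      intro h
      have h' : l ∣ m₁ := by exact_mod_cast h
      obtain ⟨m₂, rfl⟩ := h'
      exact hl.one_lt.ne' (Nat.isUnit_iff.mp (hmsq l ⟨m₂, by ring⟩))
    have hm₁0 : ((m₁ : ℤ) : ZMod l) ≠ 0 := by
      rwa [Ne, ZMod.intCast_zmod_eq_zero_iff_dvd]
    rintro ⟨e, rfl⟩
    push_cast at hdd' hpadic
    have h1 : e * d' = 112 * l * (m₁ : ℤ) ^ 2 :=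
      mul_left_cancel₀ hl0 (by linear_combination (-1 : ℤ) * hdd')
    have h2 : (l : ℤ) ∣ e * d' := ⟨112 * (m₁ : ℤ) ^ 2, by rw [h1]; ring⟩
    rcases hlp.dvd_or_dvd h2 with h3 | h3
    · obtain ⟨e₁, rfl⟩ := h3
      exact hlp.not_unit (hsqf (l : ℤ) ⟨e₁, by ring⟩)
    · obtain ⟨e', rfl⟩ := h3
      have hm : e * e' = 112 * (m₁ : ℤ) ^ 2 := mul_left_cancel₀ hl0 (by linear_combination h1)
      have hns : ¬ IsSquare ((((-21 * (m₁ : ℤ)) ^ 2 - 4 * (112 * (m₁ : ℤ) ^ 2) : ℤ)) : ZMod l) := by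
        rw [show ((-21 * (m₁ : ℤ)) ^ 2 - 4 * (112 * (m₁ : ℤ) ^ 2) : ℤ) = -7 * (m₁ : ℤ) ^ 2 by ring]
        exact not_isSquare_mul_sq_zmod hm₁0 (hinert l hl ⟨m₁, rfl⟩)
      exact not_isSoluble_padic_of_prime_dvd_coeffs (p := l) (c := -21 * (m₁ : ℤ)) (by ring) rfl rfl
        hm hns (hpadic l)
  -- so `d ∣ 14`
  have h14 : d ∣ 14 := by
    have h0 : d ∣ 112 * (m : ℤ) ^ 2 := ⟨d', hdd'⟩
    have h1 : d ∣ (14 * (m : ℤ)) ^ 4 := h0.trans ⟨343 * (m : ℤ) ^ 2, by ring⟩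
    have h2 : d ∣ 14 * (m : ℤ) := (hsqf.dvd_pow_iff_dvd (by norm_num)).mp h1
    exact (isCoprime_of_forall_prime_not_dvd hld).dvd_of_dvd_mul_right h2
  have hle : d ≤ 14 := Int.le_of_dvd (by norm_num) h14
  interval_cases d <;> first | (exfalso; omega) | simp

/-- **`S'(−21m, 112m²) = S(42m, −7m²) ⊆ {1, −7}`** (descent on the divisors of `a² − 4b = −7m²`; Silverman
X.4.9) for squarefree `m ≥ 1` all of whose prime factors `ℓ` satisfy `ℓ ≡ 1 (mod 4)`, `(−7/ℓ) = −1`: at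
`ℓ ∣ m` (`m = ℓm₁`) the reduced discriminant is `1792 m₁² = 7·(16m₁)²`, a non-residue since `(7/ℓ) = −1`;
so `d ∣ 7`; the classes `−1`, `7` have no `ℚ_7`-point (`7 ∤ m`, `7 ∥ 1792 m²`; `−1`, `−m²` non-residues).
[cite: SilvermanAEC2009, Prop. X.4.9] [cite: Zywina2025, Lemma 3.1 (proof)] -/
theorem mem_of_mem_twoIsogenySelmerGroup'_inertTwist {m : ℕ} (hm0 : 0 < m) (hmsq : Squarefree m)
    (hinert : ∀ l : ℕ, l.Prime → l ∣ m → l % 4 = 1 ∧ ¬ IsSquare ((-7 : ℤ) : ZMod l)) {d : ℤ}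
    (hd : d ∈ twoIsogenySelmerGroup' (-21 * m) (112 * m ^ 2)) :
    d ∈ ({1, -7} : Finset ℤ) := by
  haveI : Fact (Nat.Prime 7) := ⟨by norm_num⟩
  have hm0' : (m : ℤ) ≠ 0 := by exact_mod_cast hm0.ne'
  -- `7 ∤ m` (`7` is ramified, not inert)
  have hm7 : ¬ 7 ∣ m := fun h =>
    (hinert 7 (by norm_num) h).2
      ⟨0, by rw [(ZMod.intCast_zmod_eq_zero_iff_dvd (-7) 7).mpr ⟨-1, by norm_num⟩]; ring⟩
  have hm07 : ((m : ℤ) : ZMod 7) ≠ 0 := by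
    rw [Ne, ZMod.intCast_zmod_eq_zero_iff_dvd]
    exact fun h => hm7 (by exact_mod_cast h)
  have hA : (-2 * (-21 * m : ℤ)) = 42 * m := by ring
  have hB : ((-21 * m : ℤ) ^ 2 - 4 * (112 * m ^ 2)) = -7 * m ^ 2 := by ring
  rw [twoIsogenySelmerGroup'_eq, hA, hB] at hd
  have hb : (-7 * m ^ 2 : ℤ) ≠ 0 := mul_ne_zero (by norm_num) (pow_ne_zero 2 hm0')
  rw [mem_twoIsogenySelmerGroup_iff hb] at hd
  obtain ⟨hsqf, ⟨d', hdd'⟩, hloc⟩ := hd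
  have hd'eq : (-7 * m ^ 2 : ℤ) / d = d' := by
    rw [hdd', Int.mul_ediv_cancel_left _ hsqf.ne_zero]
  rw [hd'eq] at hloc
  obtain ⟨-, hpadic⟩ := hloc
  -- each prime `ℓ ∣ m`: `ℓ ∤ d`
  have hld : ∀ l : ℕ, l.Prime → l ∣ m → ¬ (l : ℤ) ∣ d := by
    intro l hl hlm
    haveI : Fact l.Prime := ⟨hl⟩
    have hlp : Prime (l : ℤ) := Nat.prime_iff_prime_int.mp hl
    have hl0 : (l : ℤ) ≠ 0 := by exact_mod_cast hl.ne_zero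
    obtain ⟨hl4, hl7⟩ := hinert l hl hlm
    have hl2 : l ≠ 2 := by rintro rfl; norm_num at hl4
    obtain ⟨m₁, rfl⟩ := hlm
    have hlm₁ : ¬ (l : ℤ) ∣ (m₁ : ℤ) := by
      intro h
      have h' : l ∣ m₁ := by exact_mod_cast h
      obtain ⟨m₂, rfl⟩ := h'
      exact hl.one_lt.ne' (Nat.isUnit_iff.mp (hmsq l ⟨m₂, by ring⟩))
    have h16 : ((16 * (m₁ : ℤ) : ℤ) : ZMod l) ≠ 0 := by
      intro h
      push_cast at h
      rcases mul_eq_zero.mp h with h | h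
      · have h2 : ((2 ^ 4 : ℕ) : ZMod l) = 0 := by exact_mod_cast h
        rw [ZMod.natCast_eq_zero_iff] at h2
        exact hl2 ((Nat.prime_dvd_prime_iff_eq hl Nat.prime_two).mp (hl.dvd_of_dvd_pow h2))
      · exact hlm₁ ((ZMod.intCast_zmod_eq_zero_iff_dvd _ l).mp (by exact_mod_cast h))
    rintro ⟨e, rfl⟩
    push_cast at hdd' hpadic
    have h1 : e * d' = -7 * l * (m₁ : ℤ) ^ 2 :=
      mul_left_cancel₀ hl0 (by linear_combination (-1 : ℤ) * hdd')
    have h2 : (l : ℤ) ∣ e * d' := ⟨-7 * (m₁ : ℤ) ^ 2, by rw [h1]; ring⟩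
    rcases hlp.dvd_or_dvd h2 with h3 | h3
    · obtain ⟨e₁, rfl⟩ := h3
      exact hlp.not_unit (hsqf (l : ℤ) ⟨e₁, by ring⟩)
    · obtain ⟨e', rfl⟩ := h3
      have hm : e * e' = -7 * (m₁ : ℤ) ^ 2 := mul_left_cancel₀ hl0 (by linear_combination h1)
      have hns : ¬ IsSquare ((((42 * (m₁ : ℤ)) ^ 2 - 4 * (-7 * (m₁ : ℤ) ^ 2) : ℤ)) : ZMod l) := by
        rw [show ((42 * (m₁ : ℤ)) ^ 2 - 4 * (-7 * (m₁ : ℤ) ^ 2) : ℤ) = 7 * (16 * (m₁ : ℤ)) ^ 2 by ring]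
        exact not_isSquare_mul_sq_zmod h16 (not_isSquare_seven_of_not_isSquare_neg_seven hl4 hl7)
      exact not_isSoluble_padic_of_prime_dvd_coeffs (p := l) (c := 42 * (m₁ : ℤ)) (by ring) rfl rfl
        hm hns (hpadic l)
  -- so `d ∣ 7`
  have h7 : d ∣ 7 := by
    have h0 : d ∣ -7 * (m : ℤ) ^ 2 := ⟨d', hdd'⟩
    have h1 : d ∣ (7 * (m : ℤ)) ^ 2 := h0.trans ⟨-7, by ring⟩
    have h2 : d ∣ 7 * (m : ℤ) := (hsqf.dvd_pow_iff_dvd (by norm_num)).mp h1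
    exact (isCoprime_of_forall_prime_not_dvd hld).dvd_of_dvd_mul_right h2
  have hle : d ≤ 7 := Int.le_of_dvd (by norm_num) h7
  have hge : -7 ≤ d := by
    have := Int.le_of_dvd (by norm_num) ((Int.neg_dvd).mpr h7)
    linarith
  have hdisc : ∀ x y : ℤ, x * y = -7 * (m : ℤ) ^ 2 →
      (7 : ℤ) ∣ (42 * (m : ℤ)) ^ 2 - 4 * x * y ∧ ¬ (7 : ℤ) ^ 2 ∣ (42 * (m : ℤ)) ^ 2 - 4 * x * y := by
    intro x y hxy
    have e1 : (42 * (m : ℤ)) ^ 2 - 4 * x * y = 1792 * (m : ℤ) ^ 2 := by rw [mul_assoc, hxy]; ring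
    rw [e1]
    exact ⟨⟨256 * (m : ℤ) ^ 2, by ring⟩, not_sq_seven_dvd_of_not_dvd hm7⟩
  have hnonres := zmod_seven_nonresidues_neg_one_neg_sq
  -- `d = -1`
  have hm1 : d ≠ -1 := by
    rintro rfl
    obtain ⟨hB1, hB2⟩ := hdisc (-1) d' hdd'.symm
    obtain ⟨-, r, hr⟩ := isSquare_zmod_of_isSoluble_padic (p := 7) (by norm_num) (by decide) hB1 hB2
      (hpadic 7)
    push_cast at hr
    exact hnonres.1 r hr.symm
  -- `d = 7`
  have hp7 : d ≠ 7 := by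
    rintro rfl
    have hd'1 : d' = -(m : ℤ) ^ 2 := by linarith
    subst hd'1
    have hsol := (isSoluble_map_twoIsogenyQuartic_comm (Int.castRingHom ℚ_[7]) (42 * (m : ℤ)) 7
      (-(m : ℤ) ^ 2)).mp (hpadic 7)
    have hnd : ¬ (7 : ℤ) ∣ -(m : ℤ) ^ 2 := by
      intro h
      have h7p : Prime (7 : ℤ) := Int.prime_iff_natAbs_prime.mpr (by norm_num)
      exact hm07 ((ZMod.intCast_zmod_eq_zero_iff_dvd _ 7).mpr (h7p.dvd_of_dvd_pow ((Int.dvd_neg).mp h)))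
    obtain ⟨hB1, hB2⟩ := hdisc (-(m : ℤ) ^ 2) 7 (by ring)
    obtain ⟨-, r, hr⟩ := isSquare_zmod_of_isSoluble_padic (p := 7) (by norm_num) hnd hB1 hB2 hsol
    push_cast at hr
    exact hnonres.2 _ r (by exact_mod_cast hm07) hr.symm
  obtain ⟨k, hk⟩ := h7
  interval_cases d <;> first | (exfalso; omega) | simp

end Summit.BirchSwinnertonDyer.BirchSwinnertonDyer.Theorems.GoldfeldGoodTwists

end
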